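import Summits.ResolutionOfSingularities.ResolutionOfSingularities.Theorems.FrobeniusClosingPatchingRelPerfectDepthLegalCurveCentre
import Summits.ResolutionOfSingularities.ResolutionOfSingularities.Theorems.FrobeniusClosingPatchingRelPerfectDepthLegalRspExchange
import HarnessLib

/-!
# Crux `PatchingRelPerfect` (stmt-ResolutionOfSingularities-16161), chain W5.2 — T6-E1b residual `LegalScopedDivisorReduction₃`,
# PHASE 2 closer (2b), spec D4 step (ii): THE POINTWISE ASSEMBLY FOR A CURVE INSIDE ONE MEMBER

[OURS · L1 W5.2 · res-L1-w52-lead-1 g5, hand #3b; spec `L/res-L1-w52-lead-1/PHASE2-STEPB-SPEC.md` §D4 ORACLE PLAN, case |A_Γ| = 1]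
Replaces the role of NO printed item; NOT a statement of the manuscript under review; fact-free.

At a point `y` of a curve germ `C_y = (w₀, w₁)` (two parameters, e.g. `(z, u)` from …DepthLegalCurveLift) lying in ONE member `F₁` of
an snc boundary `ℬ` (`F₁,y ≤ C_y`), the boundary has simple normal crossings WITH `C` at `y` as soon as somebody exhibits
`g ∈ C_y` independent modulo `𝔪²` of the equations of all members through `y` (the non-obstruction of the oracle plan): the member
equation `f₁` is a regular parameter, L3 (`span_sup_span_eq_of_isRsopPart`) rewrites `C_y = (f₁) + (g)`, and (GEN)
`SNCWithAt.centre_of_members_sup_span` with `A = {F₁}` concludes.  What remains for the oracle at `y` is ONLY the choice of `g`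
(L4: `g ∈ {z, u}` by a cotangent count, given that no other member through `y` is tangent to the host there).

AI-written; AI review is weaker than expert review.

## References
* J. Kollár, *Lectures on Resolution of Singularities* (2007), 3.104 Step 2.1. [Kollar2007]
* H. Matsumura, *Commutative Ring Theory* (1986), Thm. 14.2. [Matsumura1987]
-/

-- `Summit.<Summit>.<Sub>.Theorems` with `Sub = Summit` (single-conjunct summit, D-0017)
set_option linter.dupNamespace false

noncomputable section

open CategoryTheory CategoryTheory.Limits AlgebraicGeometry TopologicalSpace IsLocalRing
open Literature.AlgebraicGeometry.Resolution Scheme.IdealSheafData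

namespace Summit.ResolutionOfSingularities.ResolutionOfSingularities.Theorems

universe u

namespace DepthLegal

open DepthSNC

/-- [OURS · L1 W5.2] **Step (ii): pointwise assembly for a curve inside one member** (module docstring).
[cite: Kollar2007, 3.104 Step 2.1] [cite: Matsumura1987, Thm. 14.2] -/
theorem sncWithAt_curve_of_generator {E : Scheme.{u}} {ℬ : List E.IdealSheafData} {y : E} (hℬ : SNCWithAt ℬ ⊤ y)
    {C : E.IdealSheafData} (hyC : y ∈ C.support) {w : Fin 2 → E.presheaf.stalk y} (hw : IsRsopPart w)
    (hCw : stalkIdeal C y = Ideal.span (Set.range w))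
    {F₁ : E.IdealSheafData} (h₁ : F₁ ∈ ℬ) (hy₁ : y ∈ F₁.support) (hF₁C : stalkIdeal F₁ y ≤ stalkIdeal C y)
    {g : E.presheaf.stalk y} (hgC : g ∈ stalkIdeal C y)
    (hg : g ∉ (⨆ (D : E.IdealSheafData) (_ : D ∈ ℬ ∧ y ∈ D.support), stalkIdeal D y) ⊔ maximalIdeal (E.presheaf.stalk y) ^ 2) :
    SNCWithAt ℬ C y := by
  classical
  obtain ⟨hreg, d, v, hd, hv, ⟨lab, -, hlabD⟩, -⟩ := id hℬ
  haveI := hreg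
  -- the member equation is a regular parameter inside `C_y`
  have hf : stalkIdeal F₁ y = Ideal.span {v (lab ⟨F₁, h₁, hy₁⟩)} := hlabD ⟨F₁, h₁, hy₁⟩
  have hf2 : v (lab ⟨F₁, h₁, hy₁⟩) ∉ maximalIdeal (E.presheaf.stalk y) ^ 2 := by
    have h := (isRsopPart_comp_of_rsop hd v hv (fun _ : Fin 1 => lab ⟨F₁, h₁, hy₁⟩)
      (fun a b _ => Subsingleton.elim a b)).not_mem_sq 0
    exact h
  have hfC : v (lab ⟨F₁, h₁, hy₁⟩) ∈ Ideal.span (Set.range w) := by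
    rw [← hCw]; exact hF₁C (hf ▸ Ideal.mem_span_singleton_self _)
  have hgf : g ∉ Ideal.span {v (lab ⟨F₁, h₁, hy₁⟩)} ⊔ maximalIdeal (E.presheaf.stalk y) ^ 2 := by
    intro h
    have hle : Ideal.span {v (lab ⟨F₁, h₁, hy₁⟩)} ≤ ⨆ (D : E.IdealSheafData) (_ : D ∈ ℬ ∧ y ∈ D.support), stalkIdeal D y := by
      rw [← hf]; exact le_iSup₂_of_le F₁ ⟨h₁, hy₁⟩ le_rfl
    exact hg (sup_le_sup_right hle _ h)
  have hL3 := span_sup_span_eq_of_isRsopPart hw hfC (hCw ▸ hgC) hf2 hgf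
  refine hℬ.centre_of_members_sup_span hyC {F₁} (fun D hD => by rw [Set.mem_singleton_iff.mp hD]; exact ⟨h₁, hy₁⟩) g ?_ hg
  have h1 : (⨆ D ∈ ({F₁} : Set E.IdealSheafData), stalkIdeal D y) = stalkIdeal F₁ y := iSup_singleton
  rw [h1, hf, hL3, hCw]

end DepthLegal

end Summit.ResolutionOfSingularities.ResolutionOfSingularities.Theorems
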